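import Literature.AnabelianGeometry.SemiGraphs.BTempQDPairCategoryP
import Literature.AnabelianGeometry.SemiGraphs.BTempQDPairGaloisDomination

/-!
# [SemiAnbd] Thm. A.4 (proof, p. 85): the category `P` of strongly connected QD-pairs of `B^temp(Π)` is
# NONEMPTY for `Π` tempered — every Galois-domination pair `(Π/N, translations by H)` is an object
# (NV-L3 wave: `QDPair.PCore`)

S. Mochizuki, *Semi-graphs of anabelioids*, Publ. RIMS **42** (2006) 221–322, Appendix, proof of Thm. A.4
pp. 83–85 [cite: MochizukiSemiAnbd2006, Thm A.4 proof p.85]: the category `P` (there `P_i`) whose objects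
are the strongly connected QD-pairs `(B, Γ_B)` of the quasi-temperoid and whose morphisms are the classes
`Hom^`; typed by the cell as `QDPair.PCore κ` over a composition law `κ : HomHatCompLaw Π`
(`BTempQDPairCategoryP.lean`), with `HomHatCompLaw.unique` (at most one law) and
`HomHatCompLaw.transported hG` (one exists for `Π` tempered).

abc-iut cell, layer L3, PROOF-ONLY non-vacuity file (seat abc-iut-w5-d149 gen 3; row family «NV-L3»,
abc-iut-w4-d098's INHABITATION-CENSUS-L3-v1 §A1: `QDPair.PCore` has ZERO producers).  GENUINE: for `Π`
tempered, every pair `(Π/N, right translations by H)` (`QDPair.GaloisDomination.pair`, `N ⊴ Π` open,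
`H ≤ Π`; p. 83 — the Galois objects that dominate everything in the proof of Thm. A.4) is strongly
connected (`pair_isStronglyConnected`), hence an object of `P` for EVERY composition law `κ`; in
particular `P` is nonempty (take `N = Π`, the terminal one-point pair — labelled as the cheap instance),
and for the transported law the pair `(κ, object)` exists outright.  No `def`, no `instance`.
Nothing here bears on [IUTchIII] Cor. 3.12; a witness is consistency evidence, not an endorsement.
-/

namespace Literature.AnabelianGeometry.SemiGraphs

namespace QDPair

open CategoryTheory

universe u

variable {G : Type u} [Group G] [TopologicalSpace G] [IsTopologicalGroup G]

/-- **GENUINE**: for `Π` tempered, every Galois-domination pair `(Π/N, translations by H)` (`N ⊴ Π` open,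
`H ≤ Π`) is an object of the category `P` — for any composition law `κ` (they are all equal,
`HomHatCompLaw.unique`). [cite: MochizukiSemiAnbd2006, Thm A.4 proof p.85] -/
theorem PCore.exists_pair_eq_galoisDomination (hG : IsTempered G) (κ : HomHatCompLaw G)
    (N : Subgroup G) [N.Normal] (hN : IsOpen (N : Set G)) (H : Subgroup G) :
    ∃ P : PCore κ, P.pair = GaloisDomination.pair hG N hN H :=
  ⟨⟨GaloisDomination.pair hG N hN H, GaloisDomination.pair_isStronglyConnected hG N hN H⟩, rfl⟩

/-- The category `P` is NONEMPTY for `Π` tempered and any composition law `κ` (cheap instance: `N = Π`,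
the one-point pair `(Π/Π, ·)`; the genuine family is `exists_pair_eq_galoisDomination`).
[cite: MochizukiSemiAnbd2006, Thm A.4 proof p.85] -/
theorem PCore.nonempty (hG : IsTempered G) (κ : HomHatCompLaw G) : Nonempty (PCore κ) := by
  obtain ⟨P, -⟩ := PCore.exists_pair_eq_galoisDomination hG κ ⊤
    (by rw [Subgroup.coe_top]; exact isOpen_univ) ⊤
  exact ⟨P⟩

/-- For `Π` tempered the whole datum «composition law + object of `P`» exists outright: the transported
law `HomHatCompLaw.transported hG` (equal to print's by `HomHatCompLaw.unique`) and a Galois-domination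
object over it. [cite: MochizukiSemiAnbd2006, Thm A.4 proof p.85] -/
theorem PCore.exists_law_nonempty (hG : IsTempered G) :
    ∃ κ : HomHatCompLaw G, Nonempty (PCore κ) :=
  ⟨HomHatCompLaw.transported hG, PCore.nonempty hG _⟩

/-- Hom-sets of `P` at these objects are inhabited: every object carries its identity `[(id, 1̄)]`.
[cite: MochizukiSemiAnbd2006, Thm A.4 proof p.85] -/
theorem PCore.nonempty_hom_self {κ : HomHatCompLaw G} (P : PCore κ) : Nonempty (P ⟶ P) :=
  ⟨𝟙 P⟩

end QDPair

end Literature.AnabelianGeometry.SemiGraphs
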